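import Summits.PneNP.PneNP.Theorems.SfmBlMachineWalks

/-!
# Line «sfm-bl», MACHINE LAYER: legs per piece `≤ L` (the degree bound behind the walk cap) (stmt-PneNP-20523)

FRONTIER F-N1c; nothing here bears on P vs NP.

Block splitting (M1, `SfmBlMachine.pieceLegs`) puts leg `i` into block `rank / L` of its vertex, where the
rank counts the earlier legs at the same vertex; ranks are strictly increasing along a fibre
(`rankL_lt_rankL`), so a block — `L` consecutive rank values — holds at most `L` legs.  Consequently every
piece of the piece multigraph has at most `L` legs: `length_nbrs_pieceLegs_le`.  This is the `D = L` input of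
`SfmBlMachine.length_walksU_le` (`#walks_ℓ ≤ #pieces · L^ℓ`, `length_walksU_pieceLegs_le`), i.e. the cap the
§6 glue must supply to `walksC` so that `walksC_eq_walksU` applies, and the machine-side form of
`SfmBlBlockSplit.card_block_le`.
-/

set_option linter.dupNamespace false -- `Summit.PneNP.PneNP.…`: summit = sub-problem name (D-0017 single-conjunct layout)

namespace Summit.PneNP.PneNP.Theorems.SfmBlMachine

open Literature.Computability.Complexity

/-! ## Ranks increase along a fibre -/

/-- Along a left fibre the rank is strictly increasing in the leg index. -/
theorem rankL_lt_rankL (trips : List (ℕ × ℕ × ℕ)) {i i' : ℕ} (hii' : i < i') (hi' : i' < 3 * trips.length)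
    (hv : lvert trips i = lvert trips i') : rankL trips i < rankL trips i' := by
  rw [rankL_eq_countP trips (hii'.trans hi'), rankL_eq_countP trips hi', hv]
  have hsub : List.Sublist (List.range (i + 1)) (List.range i') := List.range_sublist.2 hii'
  have h1 := hsub.countP_le (p := fun k => decide (lvert trips k = lvert trips i'))
  rw [List.range_succ, List.countP_append] at h1
  have h2 : List.countP (fun k => decide (lvert trips k = lvert trips i')) [i] = 1 := by
    simp [hv]
  omega

/-- Along a right fibre the rank is strictly increasing in the leg index. -/
theorem rankR_lt_rankR (trips : List (ℕ × ℕ × ℕ)) {i i' : ℕ} (hii' : i < i') (hi' : i' < 3 * trips.length)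
    (hv : rvert trips i = rvert trips i') : rankR trips i < rankR trips i' := by
  rw [rankR_eq_countP trips (hii'.trans hi'), rankR_eq_countP trips hi', hv]
  have hsub : List.Sublist (List.range (i + 1)) (List.range i') := List.range_sublist.2 hii'
  have h1 := hsub.countP_le (p := fun k => decide (rvert trips k = rvert trips i'))
  rw [List.range_succ, List.countP_append] at h1
  have h2 : List.countP (fun k => decide (rvert trips k = rvert trips i')) [i] = 1 := by
    simp [hv]
  omega

/-- A list of indices that is strictly increasing under `f` into an interval of length `L` has length `≤ L`. -/
theorem length_le_of_strictMono_window {l : List ℕ} (hl : l.Pairwise (· < ·)) (f : ℕ → ℕ)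
    (hf : ∀ a ∈ l, ∀ b ∈ l, a < b → f a < f b) {lo L : ℕ} (hw : ∀ a ∈ l, lo ≤ f a ∧ f a < lo + L) :
    l.length ≤ L := by
  classical
  have hnd : (l.map f).Nodup := by
    have hnd0 : l.Nodup := hl.imp fun h => ne_of_lt h
    rw [List.nodup_map_iff_inj_on hnd0]
    intro a ha b hb hab
    by_contra hne
    rcases lt_or_gt_of_ne hne with h | h
    · exact absurd hab (hf a ha b hb h).ne
    · exact absurd hab (hf b hb a ha h).ne'
  have hsub : (l.map f).toFinset ⊆ Finset.Ico lo (lo + L) := by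
    intro x hx
    rw [List.mem_toFinset, List.mem_map] at hx
    obtain ⟨a, ha, rfl⟩ := hx
    exact Finset.mem_Ico.2 (hw a ha)
  calc l.length = (l.map f).length := (List.length_map _).symm
    _ = (l.map f).toFinset.card := (List.toFinset_card_of_nodup hnd).symm
    _ ≤ (Finset.Ico lo (lo + L)).card := Finset.card_le_card hsub
    _ = L := by simp

/-! ## Legs per piece -/

/-- The legs of the pieced leg list at a LEFT piece `(0, c, blk)` are indexed by the `i < 3m` with left vertex
`c` and left block `blk`. -/
theorem filter_labL_pieceLegs (L : ℕ) (trips : List (ℕ × ℕ × ℕ)) (c blk : ℕ) :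
    ((pieceLegs L trips).filter fun x => labL x = (0, c, blk))
      = ((List.range (3 * trips.length)).filter fun i => lvert trips i = c ∧ rankL trips i / L = blk).map
          (pleg L trips) := by
  unfold pieceLegs
  rw [List.filter_map]
  congr 1
  apply List.filter_congr
  intro i _
  simp [labL, pleg, Function.comp]

/-- Same on the right. -/
theorem filter_labR_pieceLegs (L : ℕ) (trips : List (ℕ × ℕ × ℕ)) (v blk : ℕ) :
    ((pieceLegs L trips).filter fun x => labR x = (1, v, blk))
      = ((List.range (3 * trips.length)).filter fun i => rvert trips i = v ∧ rankR trips i / L = blk).map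
          (pleg L trips) := by
  unfold pieceLegs
  rw [List.filter_map]
  congr 1
  apply List.filter_congr
  intro i _
  simp [labR, pleg, Function.comp]

/-- No pieced leg has a left label with side tag `≠ 0` / a right label with side tag `≠ 1`. -/
theorem filter_labL_eq_nil (L : ℕ) (trips : List (ℕ × ℕ × ℕ)) (P : Lab) (hP : P.1 ≠ 0) :
    ((pieceLegs L trips).filter fun x => labL x = P) = [] := by
  rw [List.filter_eq_nil_iff]
  intro x _
  simp only [decide_eq_true_eq]
  intro h
  exact hP (by rw [← h]; rfl)

/-- (companion of `filter_labL_eq_nil`) -/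
theorem filter_labR_eq_nil (L : ℕ) (trips : List (ℕ × ℕ × ℕ)) (P : Lab) (hP : P.1 ≠ 1) :
    ((pieceLegs L trips).filter fun x => labR x = P) = [] := by
  rw [List.filter_eq_nil_iff]
  intro x _
  simp only [decide_eq_true_eq]
  intro h
  exact hP (by rw [← h]; rfl)

/-- At most `L` legs sit in one LEFT block. -/
theorem length_filter_lblock_le {L : ℕ} (hL : 0 < L) (trips : List (ℕ × ℕ × ℕ)) (c blk : ℕ) :
    ((List.range (3 * trips.length)).filter fun i => lvert trips i = c ∧ rankL trips i / L = blk).length ≤ L := by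
  refine length_le_of_strictMono_window (List.pairwise_lt_range.sublist List.filter_sublist) (rankL trips)
    (fun a ha b hb hab => ?_) (lo := blk * L) (fun a ha => ?_)
  · simp only [List.mem_filter, List.mem_range, decide_eq_true_eq] at ha hb
    exact rankL_lt_rankL trips hab hb.1 (ha.2.1.trans hb.2.1.symm)
  · simp only [List.mem_filter, List.mem_range, decide_eq_true_eq] at ha
    have h := ha.2.2
    constructor
    · rw [← h]; exact Nat.div_mul_le_self _ _
    · rw [← h]; rw [mul_comm]; exact Nat.lt_mul_div_succ _ hL

/-- At most `L` legs sit in one RIGHT block. -/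
theorem length_filter_rblock_le {L : ℕ} (hL : 0 < L) (trips : List (ℕ × ℕ × ℕ)) (v blk : ℕ) :
    ((List.range (3 * trips.length)).filter fun i => rvert trips i = v ∧ rankR trips i / L = blk).length ≤ L := by
  refine length_le_of_strictMono_window (List.pairwise_lt_range.sublist List.filter_sublist) (rankR trips)
    (fun a ha b hb hab => ?_) (lo := blk * L) (fun a ha => ?_)
  · simp only [List.mem_filter, List.mem_range, decide_eq_true_eq] at ha hb
    exact rankR_lt_rankR trips hab hb.1 (ha.2.1.trans hb.2.1.symm)
  · simp only [List.mem_filter, List.mem_range, decide_eq_true_eq] at ha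
    have h := ha.2.2
    constructor
    · rw [← h]; exact Nat.div_mul_le_self _ _
    · rw [← h]; rw [mul_comm]; exact Nat.lt_mul_div_succ _ hL

/-- **EVERY PIECE HAS AT MOST `L` LEGS** in the piece multigraph of the block-split legs. -/
theorem length_nbrs_pieceLegs_le {L : ℕ} (hL : 0 < L) (trips : List (ℕ × ℕ × ℕ)) (P : Lab) :
    (nbrs (pieceLegs L trips) P).length ≤ L := by
  obtain ⟨s, c, blk⟩ := P
  unfold nbrs
  rw [List.length_append, List.length_map, List.length_map]
  by_cases h0 : s = 0
  · subst h0
    rw [filter_labL_pieceLegs, filter_labR_eq_nil L trips (0, c, blk) (by norm_num), List.length_map,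
      List.length_nil, add_zero]
    exact length_filter_lblock_le hL trips c blk
  · by_cases h1 : s = 1
    · subst h1
      rw [filter_labR_pieceLegs, filter_labL_eq_nil L trips (1, c, blk) (by norm_num), List.length_map,
        List.length_nil, zero_add]
      exact length_filter_rblock_le hL trips c blk
    · rw [filter_labL_eq_nil L trips (s, c, blk) h0, filter_labR_eq_nil L trips (s, c, blk) h1]
      simp

/-- **The walk counts of the block-split instance**: `#walks_ℓ ≤ #pieces · L^ℓ` (the cap to give `walksC`). -/
theorem length_walksU_pieceLegs_le {L : ℕ} (hL : 0 < L) (trips : List (ℕ × ℕ × ℕ)) (ℓ : ℕ) :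
    (walksU (pieceLegs L trips) ℓ).length ≤ (pieces (pieceLegs L trips)).length * L ^ ℓ :=
  length_walksU_le _ (length_nbrs_pieceLegs_le hL trips) ℓ

/-- The number of pieces is at most twice the number of legs, `≤ 6m`. -/
theorem length_pieces_le (plegs : List PLeg) : (pieces plegs).length ≤ 2 * plegs.length := by
  unfold pieces
  have := (List.dedup_sublist (plegs.map labL ++ plegs.map labR)).length_le
  rw [List.length_append, List.length_map, List.length_map] at this
  omega

end Summit.PneNP.PneNP.Theorems.SfmBlMachine
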